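/-
COR-CM (cell pub-hodgecm2, stage 2 of the Hodge ladder) — junction B01 `PerLFace_of_PerL`, leaf B01-H `Universe.HeckeWedge10`
(`CorCM/B01/FaceInputsSplit.lean`, p252201): the DUMMY-BRANCH reduction on the model universe (step (4) of the B01-H closing chain,
RULING B01-H-CHAIN PATHS, lead gen 5, 2026-08-21T07:00Z).  AUTHORED by the cone-audit seat prover-pub-hodgecm2-b28 (gen 25/26; staged
bytes `HOME/pub-hodgecm2-b28/staged/HeckeWedgeAnisotropicReduction.lean` v2, md5 babf465f8f4c, farm rc 0 · trio), FILED verbatim (this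
header replacing the staging header) by the single owner of B01, prover-pub-hodgecm2-own-b01-0.  Theorems only; nothing cited as a
record, nothing asserted.
-/
import Summits.HodgeConjecture.CorCM.B01.FaceInputsSplit
import Summits.HodgeConjecture.CorCM.B01.LevelCovering
import Literature.AlgebraicGeometry.Motives.ProjectiveSpaceComplexPointsOrientation
import Literature.Topology.FourManifolds.ComplexProjectiveSpaceHomologyProofs
import Literature.AlgebraicTopology.SingularHomology.UniversalCoefficientsField
import HarnessLib

/-!
# B01-H on the model universe reduces to the anisotropic (compact ball quotient) codes

`Universe.HeckeWedge10` is demanded at EVERY `(L, ι₁, V, Γ)`.  On the model universe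
`Model.universeOf hHD hI hU h₃` the surface `U.pms L ι₁ V Γ` is realised, OFF the anisotropic locus of the Picard code
`pmsCode L ι₁ V Γ` (e.g. `L` imaginary quadratic), by the total branch `ℙ²_ℂ` of `PicardCM.pmsRealisation`, whose `H¹`
vanishes (`b₁(ℙ²_ℂ(ℂ)) = 0`, Hatcher Thm. 3.19, here over `ℚ`).  Hence every degree-one class of such a surface of the
model is `0` and the leaf holds there vacuously: to discharge B01-H on the model universe it suffices to prove (or cite:
Clozel 1993 / Venkataramana 2001 Thm. 8) its body on the ANISOTROPIC codes, i.e. on genuine compact congruence ball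
quotients.

* `Model.subsingleton_bettiCohomology_projectiveSpace_one` — `H¹(ℙᴺ_ℂ(ℂ); ℚ)` is trivial (generic; belongs next to
  `finrank_complexBetti_projectiveSpace_one` in `Literature/AlgebraicGeometry/Motives/SegreHyperplaneClass.lean` if a
  Literature home is preferred);
* `Model.universeOf_cohC_pms_one_eq_zero_of_not_isAnisotropic` — off the anisotropic locus every class of
  `H¹(U.pms L ι₁ V Γ; ℂ)` of the model universe is `0`;
* `Model.universeOf_heckeWedge10_of_isAnisotropic` — `HeckeWedge10 (universeOf …)` follows from its body restricted to
  anisotropic codes; `Model.picardCMUniverse_heckeWedge10_of_isAnisotropic` — the same on `picardCMUniverse hHD hI h₁ h₃`.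
-/

noncomputable section

open scoped TensorProduct

namespace Summit.HodgeConjecture.CorCM.Model

open Literature.AlgebraicGeometry.Motives
open Literature.AlgebraicTopology.SingularHomology
open Literature.NumberTheory.Automorphic
open Literature.NumberTheory.Automorphic.PicardCM
open Literature.AlgebraicGeometry.HodgeTheory

/-- `H¹(ℙᴺ_ℂ(ℂ); ℚ) = 0`: the rational Betti cohomology of projective space in degree one is trivial
(`H₁(ℂℙᴺ; ℚ) = 0` by the cell structure, universal coefficients over a field, and Serre's homeomorphism
`ℙᴺ_ℂ(ℂ) ≃ₜ ℂℙᴺ`). [cite: HatcherAT2002, §3.1 Thm. 3.2 and §2.2 p. 140] -/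
theorem subsingleton_bettiCohomology_projectiveSpace_one (N : ℕ) :
    Subsingleton (bettiCohomology (projectiveSpace N ℂ) 1) := by
  have hz := ((Literature.Topology.FourManifolds.singularHomology_complexProjectiveSpace_of_module ℚ ℚ N 1).2
    (fun h ↦ by obtain ⟨⟨r, hr⟩, -⟩ := h; omega))
  haveI : Subsingleton (singularHomology ℚ ℚ (Literature.Topology.FourManifolds.ComplexProjectiveSpace N) 1) :=
    ModuleCat.subsingleton_of_isZero hz
  haveI : Subsingleton
      (singularCohomology ℚ ℚ (Literature.Topology.FourManifolds.ComplexProjectiveSpace N) 1) :=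
    (LinearEquiv.ofBijective _ (kroneckerPairing_bijective_of_field ℚ
      (Literature.Topology.FourManifolds.ComplexProjectiveSpace N) 1)).injective.subsingleton
  exact (singularCohomology.mapIso ℚ ℚ (complexPointsProjectiveSpaceHomeomorph N) 1).toLinearEquiv.symm
    |>.injective.subsingleton

variable (hHD : exists_isReal_hodgeModel) (hI : hodgePQ_independent_of_hodgeModel)
  (hU : BallQuotientUniformisedDatum) (h₃ : CMAbelianVarietyRealised)

/-- **Degree-one classes vanish off the anisotropic locus**: if the Picard code `pmsCode L ι₁ V Γ` is not
anisotropic, every class of `H¹(U.pms L ι₁ V Γ; ℂ)` of the model universe `U = universeOf hHD hI hU h₃` is `0`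
(the surface is realised by `ℙ²_ℂ`, and `b₁(ℙ²) = 0`). [folklore] -/
theorem universeOf_cohC_pms_one_eq_zero_of_not_isAnisotropic {L : CMField} {ι₁ : L →+* ℂ} {V : HermSpace3 L ι₁}
    (Γ : Level V) (hc : ¬ (pmsCode L ι₁ V Γ).IsAnisotropic)
    (a : (universeOf hHD hI hU h₃).CohC ((universeOf hHD hI hU h₃).pms L ι₁ V Γ) 1) : a = 0 := by
  have hX : Var.scheme hU h₃ (.pms (pmsCode L ι₁ V Γ)) = projectiveSpace 2 ℂ :=
    scheme_pms_of_not_isAnisotropic hU h₃ _ hc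
  have hsub : ∀ Y : SchemeOver ℂ, Y = projectiveSpace 2 ℂ → Subsingleton (bettiCohomology Y 1) := by
    rintro _ rfl
    exact subsingleton_bettiCohomology_projectiveSpace_one 2
  -- `U.Coh X 1 = bettiCohomology (Var.scheme hU h₃ X) 1` definitionally (`universeOf_Coh`)
  haveI : Subsingleton ((universeOf hHD hI hU h₃).Coh ((universeOf hHD hI hU h₃).pms L ι₁ V Γ) 1) := hsub _ hX
  induction a using TensorProduct.induction_on with
  | zero => rfl
  | tmul c m => rw [Subsingleton.elim m 0, TensorProduct.tmul_zero]
  | add x y hx hy => rw [hx, hy, add_zero]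

/-- **B01-H reduces to the anisotropic codes** on `universeOf hHD hI hU h₃`: if the body of `HeckeWedge10` holds at
every `(L, ι₁, V, Γ)` whose Picard code is anisotropic (genuine compact congruence ball quotients — the scope of
Clozel 1993 / Venkataramana 2001 Thm. 8), then `HeckeWedge10` holds on the model universe (elsewhere the hypotheses
`a ≠ 0` are contradictory). [folklore] -/
theorem universeOf_heckeWedge10_of_isAnisotropic
    (H : ∀ (L : CMField) (ι₁ : L →+* ℂ) (V : HermSpace3 L ι₁) (Γ : Level V),
      (pmsCode L ι₁ V Γ).IsAnisotropic →
      ∀ (a a' : (universeOf hHD hI hU h₃).CohC ((universeOf hHD hI hU h₃).pms L ι₁ V Γ) 1),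
        a ∈ ((universeOf hHD hI hU h₃).hodge ((universeOf hHD hI hU h₃).pms L ι₁ V Γ) 1).piece 1 0 →
        a' ∈ ((universeOf hHD hI hU h₃).hodge ((universeOf hHD hI hU h₃).pms L ι₁ V Γ) 1).piece 1 0 →
        a ≠ 0 → a' ≠ 0 →
          ∃ (Γ' : Level V) (g h : (universeOf hHD hI hU h₃).Mor ((universeOf hHD hI hU h₃).pms L ι₁ V Γ')
              ((universeOf hHD hI hU h₃).pms L ι₁ V Γ)),
            (universeOf hHD hI hU h₃).cup2C ((universeOf hHD hI hU h₃).pms L ι₁ V Γ') 1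
              ((universeOf hHD hI hU h₃).pullC g 1 a) ((universeOf hHD hI hU h₃).pullC h 1 a') ≠ 0) :
    (universeOf hHD hI hU h₃).HeckeWedge10 := by
  intro L ι₁ V Γ a a' ha ha' h0 h0'
  by_cases hc : (pmsCode L ι₁ V Γ).IsAnisotropic
  · exact H L ι₁ V Γ hc a a' ha ha' h0 h0'
  · exact absurd (universeOf_cohC_pms_one_eq_zero_of_not_isAnisotropic hHD hI hU h₃ Γ hc a) h0

/-- The same reduction on `picardCMUniverse hHD hI h₁ h₃` (`= universeOf hHD hI (ballQuotientUniformisedDatum_of h₁) h₃`),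
the universe over which B01 quantifies. [folklore] -/
theorem picardCMUniverse_heckeWedge10_of_isAnisotropic (h₁ : BallQuotientUniformised)
    (H : ∀ (L : CMField) (ι₁ : L →+* ℂ) (V : HermSpace3 L ι₁) (Γ : Level V),
      (pmsCode L ι₁ V Γ).IsAnisotropic →
      ∀ (a a' : (picardCMUniverse hHD hI h₁ h₃).CohC ((picardCMUniverse hHD hI h₁ h₃).pms L ι₁ V Γ) 1),
        a ∈ ((picardCMUniverse hHD hI h₁ h₃).hodge ((picardCMUniverse hHD hI h₁ h₃).pms L ι₁ V Γ) 1).piece 1 0 →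
        a' ∈ ((picardCMUniverse hHD hI h₁ h₃).hodge ((picardCMUniverse hHD hI h₁ h₃).pms L ι₁ V Γ) 1).piece 1 0 →
        a ≠ 0 → a' ≠ 0 →
          ∃ (Γ' : Level V) (g h : (picardCMUniverse hHD hI h₁ h₃).Mor ((picardCMUniverse hHD hI h₁ h₃).pms L ι₁ V Γ')
              ((picardCMUniverse hHD hI h₁ h₃).pms L ι₁ V Γ)),
            (picardCMUniverse hHD hI h₁ h₃).cup2C ((picardCMUniverse hHD hI h₁ h₃).pms L ι₁ V Γ') 1
              ((picardCMUniverse hHD hI h₁ h₃).pullC g 1 a) ((picardCMUniverse hHD hI h₁ h₃).pullC h 1 a') ≠ 0) :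
    (picardCMUniverse hHD hI h₁ h₃).HeckeWedge10 :=
  universeOf_heckeWedge10_of_isAnisotropic hHD hI (ballQuotientUniformisedDatum_of h₁) h₃ H

end Summit.HodgeConjecture.CorCM.Model

end
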